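import Literature.AlgebraicGeometry.HodgeTheory.AbelianVarietyCommutativeEndSubvarieties
import Literature.AlgebraicGeometry.HodgeTheory.AbelianVarietyHomRankIsotypicDecomposition
import HarnessLib

/-!
# The abelian subvarieties of a product of simple abelian varieties: `⨁_q B_q` with pairwise non-isogenous simple `B_q`
# has exactly the `2^{#Q}` partial products; `B × B'` with `B ≁ B'` has exactly `4`
# (Mumford §19 Cor. 1–2; Zarhin 2008 Thm. 3.2 = Lenstra–Oort–Zarhin 1996)

Layer `Literature/AlgebraicGeometry/HodgeTheory`; theorems only (no `def`, no instance, no named fact; net debt 0).  Concrete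
forms of `…MultiplicityFreeSubvarieties`, `…SubvarietiesFiniteIffMultiplicityFree`, `…SubvarietiesFiniteCriterion` and
`…EndReducedIffMultiplicityFree` for the biproduct `X = ⨁_q B_q` ITSELF (system `i_q = ι_q`, addition map `𝟙`) and for
pairs `⨁ ![B, B']` (the form in which products are written downstream, e.g. `E × T ∼ ⨁ ![E, T]`).  §1 is over any
field, §2 over a PERFECT field.

THE PRINT.  Mumford §19 Cor. 1–2 of Thm. 1 (pp. 173–174); Zarhin 2008 Thm. 3.2 (p. 7).  For `B`, `B'` simple and not
isogenous the abelian subvarieties of `B × B'` are `0`, `B × 0`, `0 × B'`, `B × B'`.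

Results (namespace `Literature.AlgebraicGeometry.HodgeTheory.AbelianVariety`):
* §1 (any field) `isIsogeny_biproduct_desc_ι` (the summand inclusions `ι_q : F_q ↪ ⨁ F` are a system with addition map `𝟙`);
* §2 (perfect field; `B_q` simple of positive dimension, pairwise non-isogenous)
  **`exists_range_eq_range_subsum_of_biproduct_simple`** (every abelian subvariety of `⨁ B` is a partial product
  `⨁_{q ∈ T} B_q ↪ ⨁ B`), **`natCard_setOf_range_subvariety_biproduct_simple`** (`= 2^{#Q}`),
  `finite_setOf_range_subvariety_biproduct_simple`, `isReduced_end_biproduct_simple`,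
  **`natCard_setOf_range_subvariety_pair`** (`⨁ ![B, B']`, `B ≁ B'`: exactly `4`), `finite_setOf_range_subvariety_pair`.
  (The isogenous pair `B ⊞ B'`, `B ∼ B'`, is infinite: `…SubvarietiesFiniteCriterion.infinite_setOf_range_subvariety_biprod_of_isIsogenous`.)

## References
* [MumfordAV1970] D. Mumford, *Abelian Varieties* (1970), §19 Thm. 1, Cor. 1–2 (pp. 173–174).
* [Zarhin2008HomomorphismsFiniteFields] Yu. G. Zarhin, *Homomorphisms of abelian varieties over finite fields* (2008)
  (arXiv:0711.1615), Thm. 3.2 (p. 7).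
* [Milne1986AbelianVarieties] J. S. Milne, *Abelian Varieties*, in Cornell–Silverman (1986), §12 Prop. 12.1 (PDF p. 189).
-/

noncomputable section

universe u

open CategoryTheory CategoryTheory.Limits

namespace Literature.AlgebraicGeometry.HodgeTheory

namespace AbelianVariety

open _root_.AlgebraicGeometry
open Literature.AlgebraicGeometry.Motives Literature.AlgebraicGeometry.Motives.AbelianVariety

variable {K : Type u} [Field K]

/-! ## §1 The summand system of a biproduct (any field) -/

section AnyField

variable {Q : Type} [Fintype Q] (F : Q → Motives.AbelianVariety K)

/-- The summand inclusions `ι_q : F_q ↪ ⨁ F` have addition map `𝟙`, an isogeny. [cite: MumfordAV1970, §19 Thm. 1 (p. 173)] -/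
theorem isIsogeny_biproduct_desc_ι : IsIsogeny (biproduct.desc fun q ↦ biproduct.ι F q) := by
  classical
  have h : biproduct.desc (fun q ↦ biproduct.ι F q) = 𝟙 (⨁ F) :=
    biproduct.hom_ext' _ _ fun q ↦ by rw [biproduct.ι_desc, Category.comp_id]
  rw [h]
  exact isIsogeny_id _

end AnyField

/-! ## §2 Products of pairwise non-isogenous simple abelian varieties (perfect field) -/

section Perfect

variable [PerfectField K] {Q : Type} [Fintype Q] {F : Q → Motives.AbelianVariety K}

/-- **EVERY ABELIAN SUBVARIETY OF `⨁_q B_q` IS A PARTIAL PRODUCT `⨁_{q ∈ T} B_q`** for pairwise non-isogenous simple `B_q` of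
positive dimension (perfect field): `range j = range (⨁_{q ∈ T} B_q ↪ ⨁ B)`. [cite: MumfordAV1970, §19 Cor. 1–2 of Thm. 1 (pp. 173–174)]
[cite: Zarhin2008HomomorphismsFiniteFields, Thm. 3.2 (p. 7)] -/
theorem exists_range_eq_range_subsum_of_biproduct_simple (hF : ∀ q, (F q).IsSimple) (hF0 : ∀ q, 0 < (F q).dim)
    (hni : ∀ q q', q ≠ q' → ¬ IsIsogenous (F q) (F q')) {Z : Motives.AbelianVariety K} (j : Z ⟶ ⨁ F)
    [IsClosedImmersion (Hom.toSchemeHom j)] :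
    ∃ T : Finset Q, Set.range (Hom.toSchemeHom j) =
      Set.range (Hom.toSchemeHom (biproduct.desc fun t : T ↦ biproduct.ι F t)) :=
  exists_range_eq_range_biproduct_desc_of_isSimple_of_perfectField (fun q ↦ biproduct.ι F q)
    (fun q ↦ isClosedImmersion_toSchemeHom_biproduct_ι F q) (isIsogeny_biproduct_desc_ι F)
    (fun _ _ hqq' f ↦ hom_simple_eq_zero_of_ne hF hF0 hni hqq' f) hF j

/-- `⨁_q B_q` (pairwise non-isogenous simple `B_q` of positive dimension) has finitely many abelian subvarieties.
[cite: Zarhin2008HomomorphismsFiniteFields, Thm. 3.2 (p. 7)] [cite: MumfordAV1970, §19 Cor. 1–2 of Thm. 1 (pp. 173–174)] -/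
theorem finite_setOf_range_subvariety_biproduct_simple (hF : ∀ q, (F q).IsSimple) (hF0 : ∀ q, 0 < (F q).dim)
    (hni : ∀ q q', q ≠ q' → ¬ IsIsogenous (F q) (F q')) :
    {R : Set (⨁ F).X.left | ∃ (Z : Motives.AbelianVariety K) (j : Z ⟶ ⨁ F),
        IsClosedImmersion (Hom.toSchemeHom j) ∧ R = Set.range (Hom.toSchemeHom j)}.Finite :=
  finite_setOf_range_subvariety_of_isIsogenous_biproduct_simple hF hF0 hni (IsIsogenous.refl _)

/-- **… exactly `2^{#Q}` of them.** [cite: MumfordAV1970, §19 Cor. 1–2 of Thm. 1 (pp. 173–174)] [cite: Zarhin2008HomomorphismsFiniteFields, Thm. 3.2 (p. 7)] -/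
theorem natCard_setOf_range_subvariety_biproduct_simple (hF : ∀ q, (F q).IsSimple) (hF0 : ∀ q, 0 < (F q).dim)
    (hni : ∀ q q', q ≠ q' → ¬ IsIsogenous (F q) (F q')) :
    Nat.card {R : Set (⨁ F).X.left | ∃ (Z : Motives.AbelianVariety K) (j : Z ⟶ ⨁ F),
        IsClosedImmersion (Hom.toSchemeHom j) ∧ R = Set.range (Hom.toSchemeHom j)} = 2 ^ Fintype.card Q :=
  natCard_setOf_range_subvariety_of_isIsogenous_biproduct_simple hF hF0 hni (IsIsogenous.refl _)

/-- `End (⨁_q B_q)` is reduced for pairwise non-isogenous simple `B_q` of positive dimension (perfect field).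
[cite: MumfordAV1970, §19 Cor. 2 of Thm. 1 (p. 174)] -/
theorem isReduced_end_biproduct_simple (hF : ∀ q, (F q).IsSimple) (hF0 : ∀ q, 0 < (F q).dim)
    (hni : ∀ q q', q ≠ q' → ¬ IsIsogenous (F q) (F q')) : _root_.IsReduced (End (⨁ F)) :=
  isReduced_end_of_isSimple_components (fun q ↦ biproduct.ι F q) (fun q ↦ isClosedImmersion_toSchemeHom_biproduct_ι F q)
    (isIsogeny_biproduct_desc_ι F) (fun _ _ hqq' f ↦ hom_simple_eq_zero_of_ne hF hF0 hni hqq' f) hF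

variable {B B' : Motives.AbelianVariety K}

/-- **`⨁ ![B, B']` for simple non-isogenous `B`, `B'` of positive dimension has EXACTLY FOUR abelian subvarieties**
(`0`, `B`, `B'`, everything; perfect field). [cite: MumfordAV1970, §19 Cor. 1–2 of Thm. 1 (pp. 173–174)]
[cite: Zarhin2008HomomorphismsFiniteFields, Thm. 3.2 (p. 7)] -/
theorem natCard_setOf_range_subvariety_pair (hB : B.IsSimple) (hB' : B'.IsSimple) (hB0 : 0 < B.dim)
    (hB0' : 0 < B'.dim) (hne : ¬ IsIsogenous B B') :
    Nat.card {R : Set (⨁ ![B, B']).X.left | ∃ (Z : Motives.AbelianVariety K) (j : Z ⟶ ⨁ ![B, B']),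
        IsClosedImmersion (Hom.toSchemeHom j) ∧ R = Set.range (Hom.toSchemeHom j)} = 4 := by
  have h := natCard_setOf_range_subvariety_biproduct_simple (F := ![B, B'])
    (by rw [Fin.forall_fin_two]; exact ⟨hB, hB'⟩) (by rw [Fin.forall_fin_two]; exact ⟨hB0, hB0'⟩)
    (by
      rw [Fin.forall_fin_two]
      refine ⟨?_, ?_⟩ <;> rw [Fin.forall_fin_two]
      · exact ⟨fun h ↦ (h rfl).elim, fun _ ↦ hne⟩
      · exact ⟨fun _ h ↦ hne h.symm', fun h ↦ (h rfl).elim⟩)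
  rwa [Fintype.card_fin] at h

/-- `⨁ ![B, B']` for simple non-isogenous `B`, `B'` of positive dimension has finitely many abelian subvarieties
(perfect field). [cite: Zarhin2008HomomorphismsFiniteFields, Thm. 3.2 (p. 7)] [cite: MumfordAV1970, §19 Cor. 1–2 of Thm. 1 (pp. 173–174)] -/
theorem finite_setOf_range_subvariety_pair (hB : B.IsSimple) (hB' : B'.IsSimple) (hB0 : 0 < B.dim)
    (hB0' : 0 < B'.dim) (hne : ¬ IsIsogenous B B') :
    {R : Set (⨁ ![B, B']).X.left | ∃ (Z : Motives.AbelianVariety K) (j : Z ⟶ ⨁ ![B, B']),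
        IsClosedImmersion (Hom.toSchemeHom j) ∧ R = Set.range (Hom.toSchemeHom j)}.Finite :=
  finite_setOf_range_subvariety_biproduct_simple (F := ![B, B'])
    (by rw [Fin.forall_fin_two]; exact ⟨hB, hB'⟩) (by rw [Fin.forall_fin_two]; exact ⟨hB0, hB0'⟩)
    (by
      rw [Fin.forall_fin_two]
      refine ⟨?_, ?_⟩ <;> rw [Fin.forall_fin_two]
      · exact ⟨fun h ↦ (h rfl).elim, fun _ ↦ hne⟩
      · exact ⟨fun _ h ↦ hne h.symm', fun h ↦ (h rfl).elim⟩)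

end Perfect

end AbelianVariety

end Literature.AlgebraicGeometry.HodgeTheory

end
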